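import Mathlib
import Summits.ValiantsHypothesis.ValiantsHypothesis.Theses.ChowBorderDepth3
import Summits.ValiantsHypothesis.ValiantsHypothesis.Theorems.ChowBorderDepth3LocalFanInTwo

/-!
# The fan-in-two rung of stub H (`stub_gradedESymBound`) of crux `ChowBorderDepth3.ChowBorderBound`
# (stmt-ValiantsHypothesis-5936), line `registered` (vertex normal form)

Stub H of the line says: for every `c`, eventually in `n`, for all `r, D ≤ (n+2)^(c⌊√n⌋+c)` there
is no GRADED ELEMENTARY-SYMMETRIC SYSTEM for `per_n`, i.e. no scalars `a_i(ε)`, linear forms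
`m_ij(ε)` (`i < r`, `j < D`) and `q` with

  `ε^d · Σ_i a_i e_d(m_i1, …, m_iD) = [d = n] ε^q per_n + ε^(q+1) G_d`   for every degree `d`.

This file proves the rung `r ≤ 2` of H (the statement of H with the extra hypothesis `r ≤ 2`),
unconditionally:

1. `local_of_graded` — summing the graded identities over `d ≤ D` turns graded data
   `(q, a, m, G_d)` into a LOCAL border expression `Σ_i a_i Π_j (1 + ε m_ij) = ε^q per_n +
   ε^(q+1) Σ_{d ≤ D} G_d` (the converse of the line's stub G); when `n > D` the degree-`n`
   identity is already contradictory.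
2. padding to exactly two summands and the proved route item `LocalFanInTwo`
   (`localFanInTwo_proof`: two local summands force `C(n,⌊n/2⌋)² ≤ 2D`);
3. the chasm arithmetic `2 · (n+2)^(c⌊√n⌋+c) < C(n,⌊n/2⌋)²` for `n ≥ (16(c+3))⁴`
   (`two_mul_chasm_lt_choose_sq`, from `2^n ≤ (n+1)·C(n,⌊n/2⌋)` and
   `(n+2)^(c⌊√n⌋+c+3) ≤ 4^n`).

So in the graded normal form the first two rungs (`r ≤ 1` trivially, `r = 2` by the logarithm and
the middle catalecticant) are settled inside the chasm range; `r ≥ 3` is the open content of H.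

References: J. M. Landsberg, *Geometry and complexity theory*, CUP 2017, §7.5.3; M. Kumar, *On the
power of border of depth-3 arithmetic circuits*, ACM ToCT 12 (2020), doi:10.1145/3371506.
-/

noncomputable section

-- `Summit.ValiantsHypothesis.ValiantsHypothesis.…` is the tree's mandated single-conjunct layout
-- (Sub = Summit), so the duplicated namespace component is intended.
set_option linter.dupNamespace false

namespace Summit.ValiantsHypothesis.ValiantsHypothesis.Theorems.ChowBorderBound.FanInTwoRung

open MvPolynomial Literature.Computability.AlgebraicComplexity
open scoped Polynomial

/-! ## Arithmetic of the chasm range against the middle binomial coefficient -/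

/-- `2^n ≤ (n+1) · C(n, ⌊n/2⌋)`: the middle binomial coefficient is the largest of the `n+1`
coefficients summing to `2^n`. -/
theorem two_pow_le_succ_mul_choose_middle (n : ℕ) : 2 ^ n ≤ (n + 1) * n.choose (n / 2) := by
  rw [← Nat.sum_range_choose n]
  calc ∑ m ∈ Finset.range (n + 1), n.choose m
      ≤ ∑ _m ∈ Finset.range (n + 1), n.choose (n / 2) :=
        Finset.sum_le_sum fun m _ => Nat.choose_le_middle m n
    _ = (n + 1) * n.choose (n / 2) := by
        rw [Finset.sum_const, Finset.card_range, smul_eq_mul]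

/-- The chasm bound is eventually far below `4^n`: for `n ≥ (16(c+3))⁴`,
`(n+2)^(c⌊√n⌋+c+3) ≤ 4^n`.  (With `u = ⌊√⌊√n⌋⌋`: `n + 2 ≤ 16^(u+1)`, the exponent is at most
`(c+3)(u+1)²`, and `4(c+3)(u+1)³ ≤ 2u⁴ ≤ 2n` once `u ≥ 16(c+3)`.) -/
theorem chasm_pow_le_four_pow (c n : ℕ) (hn : (16 * (c + 3)) ^ 4 ≤ n) :
    (n + 2) ^ (c * Nat.sqrt n + c + 3) ≤ 4 ^ n := by
  set s := Nat.sqrt n with hs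
  set u := Nat.sqrt s with hu
  have hTu : 16 * (c + 3) ≤ u := by
    rw [hu, Nat.le_sqrt', hs, Nat.le_sqrt', ← pow_mul]
    exact hn
  have hs_lt : s < (u + 1) ^ 2 := Nat.lt_succ_sqrt' s
  have hn_lt : n < (s + 1) ^ 2 := Nat.lt_succ_sqrt' n
  have hss : s ^ 2 ≤ n := Nat.sqrt_le' n
  have huu : u ^ 2 ≤ s := Nat.sqrt_le' s
  -- `n + 2 ≤ 16^(u+1)`
  have h16 : n + 2 ≤ 16 ^ (u + 1) := by
    have h2 : (s + 1) ^ 2 ≤ ((u + 1) ^ 2) ^ 2 := Nat.pow_le_pow_left hs_lt 2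
    have h3 : (u + 1) ^ 4 < 16 ^ (u + 1) := by
      calc (u + 1) ^ 4 < (2 ^ (u + 1)) ^ 4 := Nat.pow_lt_pow_left (u + 1).lt_two_pow_self (by norm_num)
        _ = 16 ^ (u + 1) := by rw [← pow_mul, mul_comm, pow_mul]; norm_num
    have h4 : ((u + 1) ^ 2) ^ 2 = (u + 1) ^ 4 := by ring
    omega
  -- the exponent
  have hK : c * s + c + 3 ≤ (c + 3) * (u + 1) ^ 2 := by
    have h1 : s + 1 ≤ (u + 1) ^ 2 := hs_lt
    nlinarith
  -- `4 (c+3) (u+1)³ ≤ 2 n`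
  have hmain : 4 * ((c + 3) * (u + 1) ^ 3) ≤ 2 * n := by
    have hu4 : u ^ 4 ≤ n :=
      calc u ^ 4 = (u ^ 2) ^ 2 := by ring
        _ ≤ s ^ 2 := Nat.pow_le_pow_left huu 2
        _ ≤ n := hss
    have h1 : (u + 1) ^ 3 ≤ 8 * u ^ 3 :=
      calc (u + 1) ^ 3 ≤ (2 * u) ^ 3 := Nat.pow_le_pow_left (by omega) 3
        _ = 8 * u ^ 3 := by ring
    have h2 : 2 * ((c + 3) * (8 * u ^ 3)) ≤ u ^ 4 :=
      calc 2 * ((c + 3) * (8 * u ^ 3)) = (16 * (c + 3)) * u ^ 3 := by ring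
        _ ≤ u * u ^ 3 := Nat.mul_le_mul_right _ hTu
        _ = u ^ 4 := by ring
    nlinarith
  calc (n + 2) ^ (c * s + c + 3)
      ≤ (16 ^ (u + 1)) ^ (c * s + c + 3) := Nat.pow_le_pow_left h16 _
    _ ≤ (16 ^ (u + 1)) ^ ((c + 3) * (u + 1) ^ 2) :=
        Nat.pow_le_pow_right (by positivity) hK
    _ = 2 ^ (4 * ((c + 3) * (u + 1) ^ 3)) := by
        rw [← pow_mul, show (16 : ℕ) = 2 ^ 4 by norm_num, ← pow_mul]
        congr 1
        ring
    _ ≤ 2 ^ (2 * n) := Nat.pow_le_pow_right (by norm_num) hmain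
    _ = 4 ^ n := by rw [pow_mul]; norm_num

/-- **Chasm versus the middle catalecticant**: for `n ≥ (16(c+3))⁴`,
`2 · (n+2)^(c⌊√n⌋+c) < C(n,⌊n/2⌋)²`. -/
theorem two_mul_chasm_lt_choose_sq (c n : ℕ) (hn : (16 * (c + 3)) ^ 4 ≤ n) :
    2 * (n + 2) ^ (c * Nat.sqrt n + c) < (n.choose (n / 2)) ^ 2 := by
  have h1 := two_pow_le_succ_mul_choose_middle n
  have h2 := chasm_pow_le_four_pow c n hn
  have h3 : 4 ^ n ≤ ((n + 1) * n.choose (n / 2)) ^ 2 :=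
    calc 4 ^ n = (2 ^ n) ^ 2 := by rw [← pow_mul, mul_comm, pow_mul]; norm_num
      _ ≤ ((n + 1) * n.choose (n / 2)) ^ 2 := Nat.pow_le_pow_left h1 2
  have h4 : 2 * (n + 1) ^ 2 < (n + 2) ^ 3 :=
    calc 2 * (n + 1) ^ 2 < 2 * (n + 2) ^ 2 :=
          Nat.mul_lt_mul_of_pos_left (Nat.pow_lt_pow_left (by omega) (by norm_num)) (by norm_num)
      _ ≤ (n + 2) * (n + 2) ^ 2 := Nat.mul_le_mul_right _ (by omega)
      _ = (n + 2) ^ 3 := by ring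
  have h5 : (n + 1) ^ 2 * (2 * (n + 2) ^ (c * Nat.sqrt n + c)) <
      (n + 1) ^ 2 * (n.choose (n / 2)) ^ 2 :=
    calc (n + 1) ^ 2 * (2 * (n + 2) ^ (c * Nat.sqrt n + c))
        = 2 * (n + 1) ^ 2 * (n + 2) ^ (c * Nat.sqrt n + c) := by ring
      _ < (n + 2) ^ 3 * (n + 2) ^ (c * Nat.sqrt n + c) :=
          Nat.mul_lt_mul_of_pos_right h4 (by positivity)
      _ = (n + 2) ^ (c * Nat.sqrt n + c + 3) := by ring
      _ ≤ 4 ^ n := h2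
      _ ≤ ((n + 1) * n.choose (n / 2)) ^ 2 := h3
      _ = (n + 1) ^ 2 * (n.choose (n / 2)) ^ 2 := by ring
  exact Nat.lt_of_mul_lt_mul_left h5

/-! ## From graded data back to a local border expression -/

variable {n r D : ℕ}

/-- For polynomials `ℓ_j` and a scalar `t`: `Π_j (1 + C t · ℓ_j) = Σ_{d ≤ D} C (t^d) · e_d(ℓ)`
(expand the product over subsets and group the subsets by cardinality). -/
theorem prod_one_add_C_mul (t : ℂ[X]) (ℓ : Fin D → MvPolynomial (Fin n × Fin n) ℂ[X]) :
    ∏ j, (1 + C t * ℓ j) =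
      ∑ d ∈ Finset.range (D + 1), C (t ^ d) *
        ∑ A ∈ Finset.powersetCard d (Finset.univ : Finset (Fin D)), ∏ j ∈ A, ℓ j := by
  classical
  rw [Finset.prod_one_add, Finset.sum_powerset, Finset.card_univ, Fintype.card_fin]
  refine Finset.sum_congr rfl fun d _ => ?_
  rw [Finset.mul_sum]
  refine Finset.sum_congr rfl fun A hA => ?_
  rw [Finset.prod_mul_distrib, Finset.prod_const, (Finset.mem_powersetCard.1 hA).2, map_pow]

/-- The border target `ε^q per_n + ε^(q+1) G` is never zero: the coefficient of the diagonal
monomial is `ε^q (1 + ε g)`. -/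
theorem target_ne_zero (q : ℕ) (G : MvPolynomial (Fin n × Fin n) ℂ[X]) :
    C (Polynomial.X ^ q) * MvPolynomial.map Polynomial.C (perPoly (Fin n) ℂ) +
      C (Polynomial.X ^ (q + 1)) * G ≠ 0 := by
  intro h
  have h0 := congrArg (coeff (∑ i, Finsupp.single (((1 : Equiv.Perm (Fin n)) i), i) 1)) h
  rw [coeff_add, coeff_C_mul, coeff_C_mul, coeff_map,
    Summit.ValiantsHypothesis.ValiantsHypothesis.Theorems.ChowBorderDepth3LocalFanInTwo.coeff_perPoly_rho,
    map_one, mul_one, coeff_zero] at h0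
  have h1 := congrArg (Polynomial.coeff · q) h0
  simp only [Polynomial.coeff_add, Polynomial.coeff_X_pow, if_true, pow_succ,
    mul_assoc, Polynomial.coeff_X_pow_mul', le_refl, Nat.sub_self, Polynomial.coeff_zero] at h1
  rw [Polynomial.mul_coeff_zero, Polynomial.coeff_X_zero, zero_mul, add_zero] at h1
  exact one_ne_zero h1

/-- **Graded ⇒ local** (converse of the line's stub G): graded data `(q, a, m, G_d)` satisfying the
elementary-symmetric system in every degree give the local border expression
`Σ_i a_i Π_j (1 + ε·m_ij) = ε^q per_n + ε^(q+1) Σ_{d ≤ D} G_d`. (If `n > D` the degree-`n`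
identity is contradictory, so the conclusion holds vacuously.) -/
theorem local_of_graded (q : ℕ) (a : Fin r → ℂ[X]) (m : Fin r → Fin D → Fin n × Fin n → ℂ[X])
    (G : ℕ → MvPolynomial (Fin n × Fin n) ℂ[X])
    (h : ∀ d : ℕ, C (Polynomial.X ^ d) *
        (∑ i, C (a i) * ∑ A ∈ Finset.powersetCard d (Finset.univ : Finset (Fin D)),
          ∏ j ∈ A, ∑ v, C (m i j v) * X v) =
      (if d = n then C (Polynomial.X ^ q) * MvPolynomial.map Polynomial.C (perPoly (Fin n) ℂ)
        else 0) + C (Polynomial.X ^ (q + 1)) * G d) :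
    ∑ i, C (a i) * ∏ j, (1 + ∑ v, C (Polynomial.X * m i j v) * X v) =
      C (Polynomial.X ^ q) * MvPolynomial.map Polynomial.C (perPoly (Fin n) ℂ) +
        C (Polynomial.X ^ (q + 1)) * ∑ d ∈ Finset.range (D + 1), G d := by
  classical
  by_cases hnD : n ≤ D
  · -- sum the graded identities over `d ≤ D`
    have hlin : ∀ i j, (∑ v, C (Polynomial.X * m i j v) * X v : MvPolynomial (Fin n × Fin n) ℂ[X]) =
        C Polynomial.X * ∑ v, C (m i j v) * X v := by
      intro i j
      rw [Finset.mul_sum]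
      exact Finset.sum_congr rfl fun v _ => by rw [map_mul, mul_assoc]
    calc ∑ i, C (a i) * ∏ j, (1 + ∑ v, C (Polynomial.X * m i j v) * X v)
        = ∑ i, C (a i) * ∑ d ∈ Finset.range (D + 1), C (Polynomial.X ^ d) *
            ∑ A ∈ Finset.powersetCard d (Finset.univ : Finset (Fin D)),
              ∏ j ∈ A, ∑ v, C (m i j v) * X v := by
          refine Finset.sum_congr rfl fun i _ => ?_
          simp_rw [hlin]
          rw [prod_one_add_C_mul]
      _ = ∑ d ∈ Finset.range (D + 1), C (Polynomial.X ^ d) *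
            (∑ i, C (a i) * ∑ A ∈ Finset.powersetCard d (Finset.univ : Finset (Fin D)),
              ∏ j ∈ A, ∑ v, C (m i j v) * X v) := by
          simp_rw [Finset.mul_sum]
          rw [Finset.sum_comm]
          refine Finset.sum_congr rfl fun d _ => Finset.sum_congr rfl fun i _ => ?_
          ring
      _ = ∑ d ∈ Finset.range (D + 1), ((if d = n then
            C (Polynomial.X ^ q) * MvPolynomial.map Polynomial.C (perPoly (Fin n) ℂ) else 0) +
            C (Polynomial.X ^ (q + 1)) * G d) := Finset.sum_congr rfl fun d _ => h d
      _ = C (Polynomial.X ^ q) * MvPolynomial.map Polynomial.C (perPoly (Fin n) ℂ) +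
            C (Polynomial.X ^ (q + 1)) * ∑ d ∈ Finset.range (D + 1), G d := by
          rw [Finset.sum_add_distrib, Finset.sum_ite_eq', if_pos (Finset.mem_range.2 (by omega)),
            Finset.mul_sum]
  · -- `n > D`: the degree-`n` identity reads `0 = ε^q per_n + ε^(q+1) G_n`
    exfalso
    have hn := h n
    rw [if_pos rfl, Finset.powersetCard_eq_empty.2 (by simpa using not_le.1 hnD)] at hn
    simp only [Finset.sum_empty, mul_zero, Finset.sum_const_zero] at hn
    exact target_ne_zero q (G n) hn.symm

/-- Padding a local border expression with `r ≤ 2` summands to exactly two summands (zero rows). -/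
theorem pad_two (hr : r ≤ 2) (a : Fin r → ℂ[X]) (mm : Fin r → Fin D → Fin n × Fin n → ℂ[X])
    (hmm : ∀ i j v, Polynomial.X ∣ mm i j v) (T : MvPolynomial (Fin n × Fin n) ℂ[X])
    (h : ∑ i, C (a i) * ∏ j, (1 + ∑ v, C (mm i j v) * X v) = T) :
    ∃ (a2 : Fin 2 → ℂ[X]) (m2 : Fin 2 → Fin D → Fin n × Fin n → ℂ[X]),
      (∀ i j v, Polynomial.X ∣ m2 i j v) ∧
      ∑ i, C (a2 i) * ∏ j, (1 + ∑ v, C (m2 i j v) * X v) = T := by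
  classical
  set e : Fin r ↪ Fin 2 := Fin.castLEEmb hr with he
  refine ⟨Function.extend e a 0, Function.extend e mm 0, fun i j v => ?_, ?_⟩
  · by_cases hi : ∃ k, e k = i
    · obtain ⟨k, rfl⟩ := hi
      rw [e.injective.extend_apply]
      exact hmm k j v
    · rw [Function.extend_apply' _ _ _ hi]
      exact dvd_zero _
  · rw [← h]
    have hzero : ∀ i ∈ (Finset.univ : Finset (Fin 2)), i ∉ Finset.univ.map e →
        C (Function.extend e a 0 i) *
          ∏ j, (1 + ∑ v, C (Function.extend e mm 0 i j v) * X v) = 0 := by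
      intro i _ hi
      have hi' : ¬ ∃ k, e k = i := by
        rintro ⟨k, rfl⟩
        exact hi (Finset.mem_map_of_mem e (Finset.mem_univ k))
      rw [Function.extend_apply' _ _ _ hi', Pi.zero_apply, map_zero, zero_mul]
    rw [← Finset.sum_subset (Finset.subset_univ _) hzero, Finset.sum_map]
    refine Finset.sum_congr rfl fun k _ => ?_
    rw [e.injective.extend_apply, e.injective.extend_apply]

/-- **Stub H, rung `r ≤ 2`** (proved): for every `c`, for `n ≥ (16(c+3))⁴` and all `r ≤ 2`,
`D ≤ (n+2)^(c⌊√n⌋+c)`, there is no graded elementary-symmetric system for `per_n` with `r` rows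
of `D` linear forms.  (Graded ⇒ local by `local_of_graded`; two local summands force
`C(n,⌊n/2⌋)² ≤ 2D` by the route item `LocalFanInTwo`; and `2(n+2)^(c⌊√n⌋+c) < C(n,⌊n/2⌋)²`.)
The statement is verbatim the registered stub `stub_gradedESymBound` with the extra hypothesis
`r ≤ 2`. -/
theorem stub_gradedESymBound_fanInTwo :
    ∀ c : ℕ, ∃ n₀ : ℕ, ∀ n ≥ n₀, ∀ r D : ℕ, r ≤ 2 → r ≤ (n + 2) ^ (c * Nat.sqrt n + c) →
    D ≤ (n + 2) ^ (c * Nat.sqrt n + c) →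
    ¬ ∃ (q : ℕ) (a : Fin r → Polynomial ℂ) (m : Fin r → Fin D → Fin n × Fin n → Polynomial ℂ)
        (G : ℕ → MvPolynomial (Fin n × Fin n) (Polynomial ℂ)),
        ∀ d : ℕ, MvPolynomial.C (Polynomial.X ^ d) *
            (∑ i, MvPolynomial.C (a i) *
              ∑ A ∈ Finset.powersetCard d (Finset.univ : Finset (Fin D)),
                ∏ j ∈ A, ∑ v, MvPolynomial.C (m i j v) * MvPolynomial.X v) =
          (if d = n then
              MvPolynomial.C (Polynomial.X ^ q) *
                MvPolynomial.map Polynomial.C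
                  (Literature.Computability.AlgebraicComplexity.perPoly (Fin n) ℂ)
            else 0) +
            MvPolynomial.C (Polynomial.X ^ (q + 1)) * G d := by
  intro c
  refine ⟨(16 * (c + 3)) ^ 4, fun n hn r D hr _ hD hex => ?_⟩
  obtain ⟨q, a, m, G, h⟩ := hex
  have hn1 : 1 ≤ n := le_trans (Nat.one_le_pow _ _ (by positivity)) hn
  have hloc := local_of_graded q a m G h
  obtain ⟨a2, m2, hm2, h2⟩ := pad_two hr a (fun i j v => Polynomial.X * m i j v)
    (fun i j v => dvd_mul_right _ _) _ hloc
  have hLFT := Summit.ValiantsHypothesis.ValiantsHypothesis.Theorems.ChowBorderDepth3LocalFanInTwo.localFanInTwo_proof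
    n D q a2 m2 (∑ d ∈ Finset.range (D + 1), G d) hn1 hm2 h2
  have hlt := two_mul_chasm_lt_choose_sq c n hn
  have : 2 * D ≤ 2 * (n + 2) ^ (c * Nat.sqrt n + c) := Nat.mul_le_mul_left 2 hD
  omega

end Summit.ValiantsHypothesis.ValiantsHypothesis.Theorems.ChowBorderBound.FanInTwoRung

end
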